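import Summits.Ventures.PercRepro.RankLevelSetUpNoQuad
import Summits.Ventures.PercRepro.RankLevelSetUpPairChain

/-! # RankLevelSetUpClassBound — THE CHAIN AT LEVEL `k` TOLERATES EVERY SERIES CLASS OF `≤ k − 2` ELEMENTS:
(↑) AND THE PAIR (↑) AT EVERY LEVEL `k ≥ 4` ON COLOOP-FREE MATROIDS OF NULLITY `≤ 4` ALL OF WHOSE SERIES CLASSES
HAVE `≤ k − 2` ELEMENTS (night-1 g40; dossier §52.18; on `RankLevelSetUpNoQuad` and `RankLevelSetUpPairChain`)

The general form of `ncard_coloops_add_two_le` / `ncard_coloops_add_two_le_of_no_quad`: a set `Y` of nonloops of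
rank `≤ ρ` with `#Y ≥ ρ + m` (`m ≥ 1`) in which every parallel class has `≤ m` elements has at most `ρ − 2` coloops
(**`ncard_coloops_add_two_le_of_class_le`**: with `ρ − 1` coloops the non-coloops would be `#Y − ρ + 1 ≥ m + 1`
pairwise parallel elements). At level `k` the chain visits the complements with `≥ k + 2 = 4 + (k − 2)` elements,
so on a coloop-free matroid of nullity `≤ 4` whose series classes all have `≤ k − 2` elements the coloop bound `2`
holds throughout (**`bound_two_of_class_le`**) and (↑) / the pair (↑) at level `k` follow from the chains
(**`upAt_of_class_le`**, **`upPairAt_of_class_le`**) — at `k = 4` this is `upAt_of_no_triple`, at `k = 5`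
`upAt_of_no_quad`; the complementary case, a class of `≥ k − 1 = (k − 4) + 3` elements, is exactly the one the
class-cut of §51.8 (c) handles (cut to `k − 2`). Every declaration has a docstring; imports: the cell's own modules
and Mathlib only. Axioms: standard. -/

namespace PercRepro

open Set Matroid

variable {α : Type}

/-- **A set `Y` of nonloops of rank `≤ ρ` with `≥ ρ + m` elements, every parallel class of which (inside `Y`) has at
most `m` elements, has at most `ρ − 2` coloops**: the non-coloops `Y'` have `#Y − #C ≥ m + 1` elements if `#C = ρ − 1`,
and then rank `1`, i.e. they lie in one parallel class. -/
lemma ncard_coloops_add_two_le_of_class_le {N : Matroid α} [N.Finite] {Y : Set α} (hYE : Y ⊆ N.E)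
    (hnl : ∀ e ∈ Y, N.IsNonloop e) {m : ℕ} (hm : 1 ≤ m) (hcls : ∀ e ∈ Y, (Y ∩ N.closure {e}).ncard ≤ m)
    {ρ : ℕ} (hρ : N.eRk Y ≤ ρ) (hY : ρ + m ≤ Y.ncard) :
    {t ∈ Y | t ∉ N.closure (Y \ {t})}.ncard + 2 ≤ ρ := by
  classical
  set C := {t ∈ Y | t ∉ N.closure (Y \ {t})} with hC
  have hYfin : Y.Finite := N.ground_finite.subset hYE
  have hCY : C ⊆ Y := fun t ht => ht.1
  have hCfin : C.Finite := hYfin.subset hCY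
  set Y' := Y \ C with hY'
  have hsplit : Y = Y' ∪ ↑hCfin.toFinset := by
    rw [hCfin.coe_toFinset, Set.sdiff_union_of_subset hCY]
  have hsk : ∀ d ∈ hCfin.toFinset, d ∉ N.closure (Y' ∪ (↑hCfin.toFinset \ {d})) := by
    intro d hd
    rw [hCfin.mem_toFinset] at hd
    intro h
    apply hd.2
    refine N.closure_subset_closure ?_ h
    rw [hCfin.coe_toFinset]
    intro x hx
    rcases hx with hx | hx
    · exact ⟨hx.1, fun h => hx.2 (by rw [Set.mem_singleton_iff] at h; rw [h]; exact hd)⟩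
    · exact ⟨hCY hx.1, hx.2⟩
  have hrk : N.eRk Y = N.eRk Y' + (hCfin.toFinset.card : ℕ∞) := by
    rw [hsplit] at hρ ⊢
    exact eRk_union_eq_add_encard_of_forall_notMem_closure hCfin.toFinset
      (by rw [hCfin.coe_toFinset]; exact hCY.trans hYE) hsk
  have hCcard : hCfin.toFinset.card = C.ncard := (Set.ncard_eq_toFinset_card C hCfin).symm
  have hold : C.ncard + 1 ≤ ρ := ncard_coloops_add_one_le hYE hnl hρ (by omega)
  have hY'card : Y'.ncard = Y.ncard - C.ncard := Set.ncard_sdiff hCY hCfin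
  have hY'fin : Y'.Finite := hYfin.subset Set.sdiff_subset
  have hY'E : Y' ⊆ N.E := Set.sdiff_subset.trans hYE
  -- the rank of `Y'` is at least `2`
  have h2 : (2 : ℕ∞) ≤ N.eRk Y' := by
    by_contra hlt
    have hlt2 : N.eRk Y' < 2 := not_le.mp hlt
    rw [← one_add_one_eq_two] at hlt2
    have hle1 : N.eRk Y' ≤ 1 := Order.le_of_lt_add_one hlt2
    have hY'pos : 0 < Y'.ncard := by omega
    obtain ⟨u, hu⟩ : Y'.Nonempty := by rwa [← Set.ncard_pos hY'fin]
    have h1 : (1 : ℕ∞) ≤ N.eRk Y' := by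
      rw [← (hnl u hu.1).eRk_eq]
      exact N.eRk_mono (Set.singleton_subset_iff.mpr hu)
    have heq : N.eRk Y' = 1 := le_antisymm hle1 h1
    obtain ⟨e, heY', -, hsub⟩ := (Matroid.eRk_eq_one_iff hY'E).mp heq
    -- `Y'` lies in the parallel class of `e`, which has `≤ m` elements of `Y`
    have hsub' : Y' ⊆ Y ∩ N.closure {e} := fun x hx => ⟨hx.1, hsub hx⟩
    have hle := Set.ncard_le_ncard hsub' (hYfin.subset Set.inter_subset_left)
    have := hcls e heY'.1
    omega
  have h3 : ((C.ncard + 2 : ℕ) : ℕ∞) ≤ ρ := by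
    calc ((C.ncard + 2 : ℕ) : ℕ∞) = (hCfin.toFinset.card : ℕ∞) + 2 := by rw [hCcard]; push_cast; ring
      _ ≤ (hCfin.toFinset.card : ℕ∞) + N.eRk Y' := by gcongr
      _ = N.eRk Y := by rw [hrk, add_comm]
      _ ≤ ρ := hρ
  exact_mod_cast h3

variable (M : Matroid α) [M.Finite]

/-- **THE COLOOP BOUND ON A COLOOP-FREE MATROID OF NULLITY `≤ 4` WHOSE SERIES CLASSES HAVE `≤ m` ELEMENTS**: for a
bi-independent `W` with `#E − #W ≥ 4 + m`, at most `2` elements of `E ∖ W` lie in `cl W`. -/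
lemma bound_two_of_class_le (hcol : ∀ e, ¬ M.IsColoop e) (hν : M✶.eRank ≤ 4) {m : ℕ} (hm : 1 ≤ m)
    (hcls : ∀ e ∈ M.E, (M✶.closure {e}).ncard ≤ m) {j : ℕ} {W : Set α} (hW : W ∈ biIndep M j)
    (hj : j + 4 + m ≤ M.E.ncard) :
    {t ∈ M.E \ W | t ∈ M.closure W}.ncard ≤ 2 := by
  rw [compl_closure_eq_dual_coloops M hW]
  have hYE : M.E \ W ⊆ M✶.E := by rw [Matroid.dual_ground]; exact Set.sdiff_subset
  have hcard : (M.E \ W).ncard = M.E.ncard - j := by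
    rw [Set.ncard_sdiff' hW.1 M.ground_finite, hW.2.1]
  have hcls' : ∀ e ∈ M.E \ W, ((M.E \ W) ∩ M✶.closure {e}).ncard ≤ m := by
    intro e he
    exact (Set.ncard_le_ncard Set.inter_subset_right
      (M.ground_finite.subset (M✶.closure_subset_ground _))).trans (hcls e he.1)
  have h := ncard_coloops_add_two_le_of_class_le (N := M✶) hYE
    (fun e he => dual_isNonloop_of_coloopFree M hcol he.1) hm hcls'
    (ρ := 4) ((M✶.eRk_le_eRank _).trans hν) (by omega)
  omega

/-- **(↑) AT EVERY LEVEL `k ≥ 4` ON A COLOOP-FREE MATROID OF NULLITY `≤ 4` ALL OF WHOSE SERIES CLASSES HAVE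
`≤ k − 2` ELEMENTS** (`2k + 2 ≤ #E`): the chain with the coloop bound `2`. -/
theorem upAt_of_class_le (hcol : ∀ e, ¬ M.IsColoop e) (hν : M✶.eRank ≤ 4) {k : ℕ} (hk4 : 4 ≤ k)
    (hcls : ∀ e ∈ M.E, (M✶.closure {e}).ncard ≤ k - 2) {b : α} (hb : b ∈ M.E) (hk : 2 * k + 2 ≤ M.E.ncard) :
    BiIndepUpAt M b k := by
  refine upAt_of_bound_two M hb (by omega) hk ?_
  intro j hkj hj W hW _
  exact bound_two_of_class_le M hcol hν (by omega) hcls hW (by omega)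

/-- **THE PAIR (↑) AT EVERY LEVEL `k ≥ 4` ON A COLOOP-FREE MATROID OF NULLITY `≤ 4` ALL OF WHOSE SERIES CLASSES
HAVE `≤ k − 2` ELEMENTS** (`2k + 2 ≤ #E`). -/
theorem upPairAt_of_class_le (hcol : ∀ e, ¬ M.IsColoop e) (hν : M✶.eRank ≤ 4) {k : ℕ} (hk4 : 4 ≤ k)
    (hcls : ∀ e ∈ M.E, (M✶.closure {e}).ncard ≤ k - 2) {b c : α} (hb : b ∈ M.E) (hc : c ∈ M.E) (hbc : b ≠ c)
    (hk : 2 * k + 2 ≤ M.E.ncard) : BiIndepUpPairAt M b c k := by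
  refine upPairAt_of_bound_two M hb hc hbc (by omega) hk ?_
  intro j hkj hj W hW _ _
  exact bound_two_of_class_le M hcol hν (by omega) hcls hW (by omega)

end PercRepro
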